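import Literature.RingTheory.MvPolynomial.HypersurfaceFunctionField
import Literature.Combinatorics.Extremal.LowDegreeSurfaceThroughLines
import Mathlib.RingTheory.AdjoinRoot
import Mathlib.RingTheory.Localization.Integral
import Mathlib.RingTheory.Polynomial.IntegralNormalization
import Mathlib.FieldTheory.IsAlgClosed.Basic
import HarnessLib

/-!
# Specialising the generic line of a surface to its closed points

Topic `Literature/RingTheory/MvPolynomial`. Everything in this file is PROVED. The last, purely
commutative-algebraic step of the function-field proof of Monge's theorem ("a surface whose
generic point carries a line is (generically) ruled") [Kollar2015, Thm. 13, §6–7]: a line on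
the surface `S = {f = 0}` defined over a finite extension `L' = L[σ]/(q)` of the function field
`L = K(S)` specialises to an honest line, defined over `K`, through every `K`-point of `S` off a
proper closed subset.

**Theorem** (`Hypersurface.exists_line_through_of_generic_line`). Let `K` be algebraically closed,
`f ∈ K[x₀,x₁,x₂]` irreducible, `q ∈ L[σ]` of positive degree, `s` its class in
`L' = L[σ]/(q)`, and `V₀, V₁ ∈ K[x]³`. If the line through the generic point with direction
`V̄₀ + s V̄₁` lies on `S`, i.e. `f(x̄ + t (V̄₀ + s V̄₁)) = 0` in `L'[t]`, then there is `b ∈ K[x]`,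
`f ∤ b`, such that for every `p ∈ S(K)` with `b(p) ≠ 0` there is `s₀ ∈ K` with
`f(p + t (V₀(p) + s₀ V₁(p))) = 0` for all `t ∈ K`.

Proof: clear denominators (`IsLocalization.integerNormalization`, then
`Polynomial.integralNormalization`): for a suitable `0 ≠ c ∈ A = K[x]/(f)` the element `c̄ s` is
a root of a MONIC `q₁ ∈ A[σ]` of the same degree, and `P(c̄ s) = 0` for `P ∈ A[σ]` forces
`q₁ ∣ P` in `A[σ]` (division by the monic `q₁`, uniqueness of remainders in `L[σ]`,
injectivity of `A → L`). Apply this to the `t`-coefficients of `f(x̄ + t (c̄ V̄₀ + σ' V̄₁))`,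
evaluate at `p` (`A → K`, possible since `f(p) = 0`), and pick a root `s₀'` of the monic
specialised `q₁` (`K` algebraically closed).

## References
* [Kollar2015] J. Kollár, *Szemerédi–Trotter-type theorems in dimension 3*, Adv. Math. 271
  (2015), Theorem 13, §§6–7 (Monge; ruled surfaces).
-/

namespace Literature.RingTheory.MvPolynomial

open Polynomial

/-! ### Transport of `MvPolynomial.aeval` along ring maps compatible with the scalars -/

section Transport

variable {K : Type*} [CommSemiring K] {R S : Type*} [CommSemiring R] [CommSemiring S]
  [Algebra K R] [Algebra K S] {ι : Type*}

/-- A ring map compatible with the structure maps commutes with `MvPolynomial.aeval`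
(a `rw`-robust form of `MvPolynomial.comp_aeval`). [folklore] -/
theorem ringHom_mvPolynomial_aeval (θ : R →+* S)
    (hθ : ∀ c, θ (algebraMap K R c) = algebraMap K S c) (v : ι → R) (P : MvPolynomial ι K) :
    θ (MvPolynomial.aeval v P) = MvPolynomial.aeval (fun i => θ (v i)) P := by
  induction P using MvPolynomial.induction_on with
  | C a => rw [MvPolynomial.algHom_C, MvPolynomial.algHom_C, hθ]
  | add p q hp hq => simp only [map_add, hp, hq]
  | mul_X p i hp =>
    simp only [map_mul, MvPolynomial.aeval_X]
    rw [hp]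

/-- Rescaling the parameter of a polynomial line: if `P(a + t v) = 0` in `R[t]` then
`P(a + t (κ v)) = 0`. [folklore] -/
theorem aeval_line_smul_eq_zero {R : Type*} [CommRing R] [Algebra K R] (a v : ι → R) (κ : R)
    (P : MvPolynomial ι K) (h : MvPolynomial.aeval (fun i => C (a i) + C (v i) * X) P = 0) :
    MvPolynomial.aeval (fun i => C (a i) + C (κ * v i) * X) P = 0 := by
  have key := ringHom_mvPolynomial_aeval (K := K) (compRingHom (C κ * X) : R[X] →+* R[X])
    (fun c => by rw [Polynomial.algebraMap_apply, coe_compRingHom_apply, C_comp])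
    (fun i => C (a i) + C (v i) * X) P
  rw [h, map_zero] at key
  have hfun : (fun i => C (a i) + C (κ * v i) * X) =
      fun i => compRingHom (C κ * X) (C (a i) + C (v i) * X) := by
    funext i
    rw [coe_compRingHom_apply, add_comp, mul_comp, C_comp, C_comp, X_comp, ← mul_assoc, ← C_mul,
      mul_comm (v i)]
  rw [hfun, ← key]

end Transport

/-! ### Division by a monic integral model -/

section Division

variable {A L : Type*} [CommRing A] [Field L]

/-- **Divisibility descends to the integral model.** Let `ι : A → L` be injective, `q₁ ∈ A[X]`
monic, `q ∈ L[X]` with `deg q₁ ≤ deg q`, `β ∈ Lˣ`, and suppose `q ∣ q₁(βX)`. If `q ∣ P(βX)`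
for `P ∈ A[X]` then `q₁ ∣ P` in `A[X]`. [folklore] -/
theorem dvd_of_dvd_map_comp (ι : A →+* L) (hι : Function.Injective ι) {q₁ : A[X]}
    (hq₁ : q₁.Monic) (h0 : q₁.natDegree ≠ 0) {q : L[X]} (hdeg : q₁.natDegree ≤ q.natDegree)
    {β : L} (hβ : β ≠ 0) (hq : q ∣ (q₁.map ι).comp (C β * X)) {P : A[X]}
    (hP : q ∣ (P.map ι).comp (C β * X)) : q₁ ∣ P := by
  have hq₁L : (q₁.map ι).Monic := hq₁.map ι
  have hq₁L1 : q₁.map ι ≠ 1 := by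
    intro h1
    have := congrArg natDegree h1
    rw [hq₁.natDegree_map, natDegree_one] at this
    exact h0 this
  -- undo the scaling `X ↦ βX`
  have hundo : ∀ R : L[X], (R.comp (C β * X)).comp (C β⁻¹ * X) = R := fun R => by
    rw [Polynomial.comp_assoc, mul_comp, C_comp, X_comp, ← mul_assoc, ← C_mul,
      mul_inv_cancel₀ hβ, C_1, one_mul, Polynomial.comp_X]
  -- division with remainder by the monic `q₁` in `L[X]`
  set ρ : L[X] := P.map ι %ₘ q₁.map ι with hρ_def
  have hdiv : ρ = P.map ι - q₁.map ι * (P.map ι /ₘ q₁.map ι) := by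
    rw [eq_sub_iff_add_eq, hρ_def]
    exact modByMonic_add_div _ _
  have hρq : q ∣ ρ.comp (C β * X) := by
    rw [hdiv, sub_comp, mul_comp]
    exact dvd_sub hP (dvd_mul_of_dvd_left hq _)
  have hρlt : (ρ.comp (C β * X)).natDegree < q.natDegree :=
    calc (ρ.comp (C β * X)).natDegree ≤ ρ.natDegree * (C β * X).natDegree := natDegree_comp_le
      _ = ρ.natDegree := by rw [natDegree_C_mul_X β hβ, mul_one]
      _ < (q₁.map ι).natDegree := natDegree_modByMonic_lt _ hq₁L hq₁L1
      _ = q₁.natDegree := hq₁.natDegree_map ι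
      _ ≤ q.natDegree := hdeg
  have hρ0 : ρ = 0 := by
    rw [← hundo ρ, eq_zero_of_dvd_of_natDegree_lt hρq hρlt, zero_comp]
  have hmod : (P %ₘ q₁).map ι = 0 := by rw [map_modByMonic ι hq₁, ← hρ_def, hρ0]
  rw [← modByMonic_eq_zero_iff_dvd hq₁]
  exact map_injective ι hι (by rw [hmod, Polynomial.map_zero])

/-- Vanishing at `β s` in `L[X]/(q)` is divisibility of `P(βX)` by `q`. [folklore] -/
theorem dvd_comp_of_eval₂_eq_zero (ι : A →+* L) (q : L[X]) (β : L) (P : A[X])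
    (h : P.eval₂ ((AdjoinRoot.of q).comp ι) (AdjoinRoot.of q β * AdjoinRoot.root q) = 0) :
    q ∣ (P.map ι).comp (C β * X) := by
  rw [← AdjoinRoot.mk_eq_zero, ← AdjoinRoot.aeval_eq, aeval_def, AdjoinRoot.algebraMap_eq,
    eval₂_comp, eval₂_mul, eval₂_C, eval₂_X, eval₂_map]
  exact h

end Division

/-! ### The specialisation theorem -/

namespace Hypersurface

variable {K : Type*} [Field K] (f : MvPolynomial (Fin 3) K) [Fact (Irreducible f)]

/-- Evaluation at a point of the surface, on the coordinate ring `K[x]/(f)`. [folklore] -/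
noncomputable def evalAt (p : Fin 3 → K) (hp : MvPolynomial.eval p f = 0) : CoordRing f →+* K :=
  Ideal.Quotient.lift (Ideal.span {f}) (MvPolynomial.eval p) fun a ha => by
    obtain ⟨c, rfl⟩ := Ideal.mem_span_singleton.1 ha
    rw [map_mul, hp, zero_mul]

omit [Fact (Irreducible f)] in
/-- `evalAt` on the class of a polynomial. [folklore] -/
theorem evalAt_mk (p : Fin 3 → K) (hp : MvPolynomial.eval p f = 0)
    (g : MvPolynomial (Fin 3) K) :
    evalAt f p hp (Ideal.Quotient.mk (Ideal.span {f}) g) = MvPolynomial.eval p g :=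
  Ideal.Quotient.lift_mk _ _ _

omit [Fact (Irreducible f)] in
/-- The structure map `K → K[x]/(f)` on elements. [folklore] -/
theorem algebraMap_coordRing (c₀ : K) :
    algebraMap K (CoordRing f) c₀ = Ideal.Quotient.mk (Ideal.span {f}) (MvPolynomial.C c₀) :=
  rfl

/-- **Specialisation of the generic line.** Let `K` be algebraically closed, `f` irreducible,
`q ∈ L[σ]` of positive degree over the function field `L` of `{f = 0}`, `s` the class of
`σ` in `L' = L[σ]/(q)`, and `V₀, V₁ ∈ K[x]³`. If
`f(x̄ + t (V̄₀ + s V̄₁)) = 0` in `L'[t]` (the line through the generic point with direction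
`V̄₀ + s V̄₁` lies on the surface), then there is `b ∉ (f)` such that through every point `p` of
`{f = 0} ∖ {b = 0}` there passes a line of the surface with direction `V₀(p) + s₀ V₁(p)` for
some `s₀ ∈ K`. [cite: Kollar2015, Theorem 13 and §7 (ruled surfaces; specialisation of the
generic ruling)] -/
theorem exists_line_through_of_generic_line [IsAlgClosed K] (q : Polynomial (FnField f))
    (hq0 : q.natDegree ≠ 0) (V₀ V₁ : Fin 3 → MvPolynomial (Fin 3) K)
    (H : MvPolynomial.aeval (fun i =>
        C (algebraMap (FnField f) (AdjoinRoot q) (toFn f (MvPolynomial.X i))) +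
          C (algebraMap (FnField f) (AdjoinRoot q) (toFn f (V₀ i)) +
              AdjoinRoot.root q * algebraMap (FnField f) (AdjoinRoot q) (toFn f (V₁ i))) * X)
        f = 0) :
    ∃ b : MvPolynomial (Fin 3) K, ¬ f ∣ b ∧ ∀ p : Fin 3 → K, MvPolynomial.eval p f = 0 →
      MvPolynomial.eval p b ≠ 0 → ∃ s₀ : K, ∀ t : K,
        MvPolynomial.eval (p + t • fun i => MvPolynomial.eval p (V₀ i) +
          s₀ * MvPolynomial.eval p (V₁ i)) f = 0 := by
  -- the maps `A = K[x]/(f) → L → L'`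
  have hι : Function.Injective (algebraMap (CoordRing f) (FnField f)) :=
    IsFractionRing.injective (CoordRing f) (FnField f)
  set φ : CoordRing f →+* AdjoinRoot q :=
    (AdjoinRoot.of q).comp (algebraMap (CoordRing f) (FnField f)) with hφ_def
  have hφ : ∀ g, φ (Ideal.Quotient.mk (Ideal.span {f}) g) = AdjoinRoot.of q (toFn f g) :=
    fun g => rfl
  have hφ' : ∀ a, φ a = AdjoinRoot.of q (algebraMap (CoordRing f) (FnField f) a) := fun a => rfl
  -- Step 1: an integral model `q₁ ∈ A[σ]` (monic, same degree) of `q`, with root `β s`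
  obtain ⟨b, hbM, hb⟩ :=
    IsLocalization.integerNormalization_spec (nonZeroDivisors (CoordRing f)) q
  set Qb : Polynomial (CoordRing f) :=
    IsLocalization.integerNormalization (nonZeroDivisors (CoordRing f)) q with hQb_def
  have hb0 : algebraMap (CoordRing f) (FnField f) b ≠ 0 := fun h =>
    nonZeroDivisors.ne_zero hbM ((injective_iff_map_eq_zero _).1 hι b h)
  have hQbmap : Qb.map (algebraMap (CoordRing f) (FnField f)) =
      C (algebraMap (CoordRing f) (FnField f) b) * q := by
    rw [hb, ← IsScalarTower.algebraMap_smul (FnField f) b q, smul_eq_C_mul]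
  have hQbdeg : Qb.natDegree = q.natDegree := by
    rw [← natDegree_map_eq_of_injective hι Qb, hQbmap, natDegree_C_mul hb0]
  have hQb0 : Qb ≠ 0 := by
    intro h
    rw [h, natDegree_zero] at hQbdeg
    exact hq0 hQbdeg.symm
  have hQb1 : 1 ≤ Qb.natDegree := by rw [hQbdeg]; exact Nat.one_le_iff_ne_zero.2 hq0
  set q₁ : Polynomial (CoordRing f) := Qb.integralNormalization with hq₁_def
  have hq₁m : q₁.Monic := monic_integralNormalization hQb0
  have hq₁deg : q₁.natDegree = q.natDegree := by
    rw [hq₁_def, natDegree_integralNormalization, hQbdeg]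
  have hc0 : Qb.leadingCoeff ≠ 0 := leadingCoeff_ne_zero.2 hQb0
  have hβ0 : algebraMap (CoordRing f) (FnField f) Qb.leadingCoeff ≠ 0 := fun h =>
    hc0 ((injective_iff_map_eq_zero _).1 hι _ h)
  -- `Qb(s) = 0` and `q₁(β s) = 0` in `L'`, `β = leading coefficient of Qb`
  have hQbs : Qb.eval₂ φ (AdjoinRoot.root q) = 0 := by
    rw [hφ_def, ← eval₂_map, hQbmap, eval₂_mul, eval₂_C, AdjoinRoot.eval₂_root, mul_zero]
  have hq₁s : q₁.eval₂ φ (φ Qb.leadingCoeff * AdjoinRoot.root q) = 0 := by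
    rw [hq₁_def, integralNormalization_eval₂_leadingCoeff_mul hQb1 φ (AdjoinRoot.root q), hQbs,
      mul_zero]
  have hqq₁ : q ∣ (q₁.map (algebraMap (CoordRing f) (FnField f))).comp
      (C (algebraMap (CoordRing f) (FnField f) Qb.leadingCoeff) * X) :=
    dvd_comp_of_eval₂_eq_zero _ q _ q₁ hq₁s
  -- Step 2: a lift `bt ∈ K[x]` of the leading coefficient, the rescaled line polynomial
  -- `G₀ = f(x + t (bt V₀ + σ' V₁)) ∈ K[x][σ'][t]`; its `t`-coefficients are divisible by `q₁`
  -- modulo `f`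
  obtain ⟨bt, hbt⟩ := Ideal.Quotient.mk_surjective Qb.leadingCoeff
  set ψ : MvPolynomial (Fin 3) K →+* AdjoinRoot q := φ.comp (Ideal.Quotient.mk (Ideal.span {f}))
    with hψ_def
  have hψ : ∀ g, ψ g = AdjoinRoot.of q (toFn f g) := fun g => rfl
  have hψbt : ψ bt = φ Qb.leadingCoeff := by rw [hψ_def, RingHom.comp_apply, hbt]
  set W₀ : Fin 3 → Polynomial (MvPolynomial (Fin 3) K) := fun i => C (bt * V₀ i) + X * C (V₁ i)
    with hW₀_def
  set G₀ : Polynomial (Polynomial (MvPolynomial (Fin 3) K)) := MvPolynomial.aeval (fun i =>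
    C (C (MvPolynomial.X i)) + C (W₀ i) * X) f with hG₀_def
  have hG₀map : G₀.map (eval₂RingHom ψ (φ Qb.leadingCoeff * AdjoinRoot.root q)) = 0 := by
    have hθ : ∀ c₀ : K, mapRingHom (eval₂RingHom ψ (φ Qb.leadingCoeff * AdjoinRoot.root q))
        (algebraMap K (Polynomial (Polynomial (MvPolynomial (Fin 3) K))) c₀) =
          algebraMap K (Polynomial (AdjoinRoot q)) c₀ := by
      intro c₀
      rw [Polynomial.algebraMap_apply, Polynomial.algebraMap_apply, Polynomial.algebraMap_apply,
        MvPolynomial.algebraMap_eq, coe_mapRingHom, Polynomial.map_C, coe_eval₂RingHom, eval₂_C,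
        hψ, MvPolynomial.algHom_C, IsScalarTower.algebraMap_apply K (FnField f) (AdjoinRoot q),
        AdjoinRoot.algebraMap_eq]
    have key := ringHom_mvPolynomial_aeval (K := K)
      (mapRingHom (eval₂RingHom ψ (φ Qb.leadingCoeff * AdjoinRoot.root q))) hθ
      (fun i => C (C (MvPolynomial.X i)) + C (W₀ i) * X) f
    rw [← hG₀_def, coe_mapRingHom] at key
    rw [key]
    have H' := aeval_line_smul_eq_zero (K := K) _ _ (φ Qb.leadingCoeff) f H
    convert H' using 3
    funext i
    simp only [hW₀_def, Polynomial.map_add, Polynomial.map_mul, Polynomial.map_C,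
      Polynomial.map_X, coe_eval₂RingHom, eval₂_C, eval₂_X, map_mul, hψ,
      AdjoinRoot.algebraMap_eq, map_add]
    rw [← hψ bt, hψbt]
    ring
  have hGcoeff : ∀ j, q₁ ∣ (G₀.coeff j).map (Ideal.Quotient.mk (Ideal.span {f})) := by
    intro j
    refine dvd_of_dvd_map_comp _ hι hq₁m (by rw [hq₁deg]; exact hq0) hq₁deg.le hβ0 hqq₁
      (dvd_comp_of_eval₂_eq_zero _ q _ _ ?_)
    have h := congrArg (fun R => R.coeff j) hG₀map
    simp only [Polynomial.coeff_map, coe_eval₂RingHom, coeff_zero] at h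
    rw [eval₂_map]
    exact h
  -- Step 3: the exceptional polynomial `bt` and the points `p` with `bt(p) ≠ 0`
  refine ⟨bt, ?_, ?_⟩
  · intro hdvd
    apply hc0
    rw [← hbt, Ideal.Quotient.eq_zero_iff_mem, Ideal.mem_span_singleton]
    exact hdvd
  intro p hpf hpb
  set ev : CoordRing f →+* K := evalAt f p hpf with hev_def
  have hev : ∀ g, ev (Ideal.Quotient.mk (Ideal.span {f}) g) = MvPolynomial.eval p g :=
    fun g => evalAt_mk f p hpf g
  -- a root `s₁` of the specialised (still monic) `q₁`
  have hq₁p : (q₁.map ev).degree ≠ 0 := by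
    rw [degree_eq_natDegree (hq₁m.map ev).ne_zero, hq₁m.natDegree_map ev, hq₁deg]
    exact_mod_cast hq0
  obtain ⟨s₁, hs₁⟩ := IsAlgClosed.exists_root _ hq₁p
  -- all `t`-coefficients of the specialised line polynomial vanish at `s₁`
  set θ : Polynomial (MvPolynomial (Fin 3) K) →+* K := eval₂RingHom (MvPolynomial.eval p) s₁
    with hθ_def
  have hθmk : (ev.comp (Ideal.Quotient.mk (Ideal.span {f})) : MvPolynomial (Fin 3) K →+* K) =
      (MvPolynomial.eval p : MvPolynomial (Fin 3) K →+* K) := RingHom.ext hev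
  have hGθ : G₀.map θ = 0 := by
    refine Polynomial.ext fun j => ?_
    rw [Polynomial.coeff_map, coeff_zero, hθ_def, coe_eval₂RingHom, eval₂_eq_eval_map, ← hθmk,
      ← Polynomial.map_map]
    exact eval_eq_zero_of_dvd_of_eval_eq_zero (Polynomial.map_dvd ev (hGcoeff j)) hs₁
  -- transport: `G₀.map θ` is the line polynomial at `p`, direction `bt(p) V₀(p) + s₁ V₁(p)`
  have hθK : ∀ c₀ : K, mapRingHom θ
      (algebraMap K (Polynomial (Polynomial (MvPolynomial (Fin 3) K))) c₀) =
        algebraMap K (Polynomial K) c₀ := by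
    intro c₀
    rw [Polynomial.algebraMap_apply, Polynomial.algebraMap_apply, Polynomial.algebraMap_apply,
      MvPolynomial.algebraMap_eq, coe_mapRingHom, Polynomial.map_C, hθ_def, coe_eval₂RingHom,
      eval₂_C, MvPolynomial.eval_C, Algebra.algebraMap_self_apply]
  have hline : MvPolynomial.aeval (fun i => C (p i) + C (MvPolynomial.eval p bt *
      MvPolynomial.eval p (V₀ i) + s₁ * MvPolynomial.eval p (V₁ i)) * X) f = 0 := by
    have key := ringHom_mvPolynomial_aeval (K := K) (mapRingHom θ) hθK
      (fun i => C (C (MvPolynomial.X i)) + C (W₀ i) * X) f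
    rw [← hG₀_def, coe_mapRingHom, hGθ] at key
    convert key.symm using 3
    funext i
    simp only [hW₀_def, Polynomial.map_add, Polynomial.map_mul, Polynomial.map_C,
      Polynomial.map_X, hθ_def, coe_eval₂RingHom, eval₂_C, eval₂_add, eval₂_mul, eval₂_X,
      map_mul, MvPolynomial.eval_X]
  -- the line through `p` with direction `V₀(p) + (s₁ / bt(p)) V₁(p)`
  refine ⟨s₁ / MvPolynomial.eval p bt, fun t => ?_⟩
  have h := Literature.Combinatorics.Extremal.eval_aeval_line p
    (fun i => MvPolynomial.eval p bt * MvPolynomial.eval p (V₀ i) +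
      s₁ * MvPolynomial.eval p (V₁ i)) f (t / MvPolynomial.eval p bt)
  rw [hline, eval_zero] at h
  have hdir : (p + t • fun i => MvPolynomial.eval p (V₀ i) +
      s₁ / MvPolynomial.eval p bt * MvPolynomial.eval p (V₁ i)) =
        p + (t / MvPolynomial.eval p bt) • fun i => MvPolynomial.eval p bt *
          MvPolynomial.eval p (V₀ i) + s₁ * MvPolynomial.eval p (V₁ i) := by
    funext i
    simp only [Pi.add_apply, Pi.smul_apply, smul_eq_mul]
    field_simp
  rw [hdir]
  exact h.symm

end Hypersurface

end Literature.RingTheory.MvPolynomial
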